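import Summits.BirchSwinnertonDyer.BirchSwinnertonDyer.Theorems.ManinLocalTwoThreeTameThreeNeronScalarIIIstar
import HarnessLib

/-!
# The tame Néron-scalar law at `3` on the `III*` stratum, valuations: the `u = 1` Vélu pair of a rational `3`-line has
# `ord₃ Δ = 15`, the `u = 3` pair is a type-`III` pair (E-an-108 `TameThreeNeronScalarLawIIIstar`, conjunct 3, PROVED)

Summit `BirchSwinnertonDyer`, route `ManinLocalTwoThree` (cell bsd-f2-manin), crux C3 `ManinPrimeToThreeAtNine`
(stmt-BirchSwinnertonDyer-22968); sequel of `…TameThreeNeronScalarIIIstar` (p642603: conjunct 1, the `u = 1` Vélu pair is not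
a minimal pair).  Here the DISCRIMINANT of the pair is computed exactly: for `W/ℚ` globally minimal, `9 ∥ N`,
`ord₃ Δ_min = 9`, `ord₃ j ≥ 0` (pot.-good `III*`) and `Ψ₃(q − b₂/12) = 0`, there is an integer `U`, `3 ∤ U`, with
`256·Δ(T) = 3¹⁵·U` for EVERY curve `T` carrying the `u = 1` Vélu pair `(1440q² − 9c₄, 60480q³ − 756c₄q − 27c₆)` and
`256·Δ(T') = 3³·U` for every `T'` carrying the `u = 3` pair (`(3⁴c₄, 3⁶c₆)(T')` = the Vélu pair)
(`exists_unit_velu_three_Δ_of_IIIstar`).  Consequences: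

* `padicValInt_minimalDiscriminantInt_eq_three_of_three_velu_three_of_IIIstar` — E-an-108 conjunct 3 VERBATIM (after
  unfolding an's `veluC4`/`veluC6`): every globally minimal `W'` with `3⁴c₄(W') = 1440q² − 9c₄(W)`,
  `3⁶c₆(W') = 60480q³ − 756c₄(W)q − 27c₆(W)` has `ord₃ Δ_min(W') = 3` (the `3`-quotient is of type `III`);
* `padicValRat_Δ_eq_fifteen_of_velu_three_of_IIIstar` — the `u = 1` Vélu pair itself has `ord₃ Δ = 15` (so, again, it is
  no minimal pair: `15 ∉ {3, 9}`; cf. p642603).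

THE UNIT: with p642603's integers (`b₂ = 9β − 12r, …`, `3 ∤ γ`, `4ε = 3βδ − γ²`; root `4q − 3β = 3z`, `3 ∤ z`, `z + β = 3σ`)
the root relation reads `576σδ = (z² − 8γ)² − 4σz³` (★), the `u = 3` pair is that of the `3`-integral model
`M = [0, 3σ/4, 0, −3A/16, −(B + 8σA)/64]` (`A = 6σz − z² + 8γ`, `B = −2z³ + 9σz² + 24γz + 144δ`), and
`256·Δ(M) = 27·U`, `U = 4σ³(B + 8σA) + 3σ²A² + 4A³ − (B + 8σA)² + 6σA(B + 8σA)`; `3 ∤ U` is a finite check over `ZMod 3`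
of the residues allowed by (★), `3 ∤ z`, `3 ∤ γ` (`decide`).

HONEST FRAMING: local theorems about Weierstrass models; C3, Manin's conjecture and BSD are not proved.  No definitions, no
named facts, no sorry.  Sanity instance `36a3`: `U`-value gives `Δ(36a1) = −2⁴3³`.

References: [SilvermanATAEC1994] IV.9.4 Steps 6–9, Table 4.1; [SilvermanAEC2009] III.1, VII.1; J. Vélu, C. R. Acad. Sci.
Paris 273 (1971); [DokchitserDokchitser2015LocalInvariants] Table 1; cell memo HOME/MEMO-an.md §66 (E-an-108; census
8 650 / 8 650 `III* → III` edges, `u = 3`).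
-/

set_option linter.dupNamespace false
set_option autoImplicit false

noncomputable section

open scoped Classical

open WeierstrassCurve IsDedekindDomain NumberField Rat.HeightOneSpectrum Polynomial
  Literature.NumberTheory.DiophantineGeometry Literature.NumberTheory.EllipticCurves
  Summit.BirchSwinnertonDyer.Rank1Residual.Additive

namespace Summit.BirchSwinnertonDyer.BirchSwinnertonDyer.Theorems.ManinLocalTwoThree

/-! ### §1. The unit: a finite check over `ZMod 3` -/

/-- The residues mod `3` allowed by (★), `3 ∤ z`, `3 ∤ γ` make `U` a unit (finite check). -/
private theorem unit_IIIstar_decide : ∀ s z g d : ZMod 3, z ≠ 0 → g ≠ 0 →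
    (z ^ 2 - 8 * g) ^ 2 - 4 * s * z ^ 3 - 576 * s * d = 0 →
    4 * s ^ 3 * ((-2 * z ^ 3 + 9 * s * z ^ 2 + 24 * g * z + 144 * d) + 8 * s * (6 * s * z - z ^ 2 + 8 * g)) +
      3 * s ^ 2 * (6 * s * z - z ^ 2 + 8 * g) ^ 2 + 4 * (6 * s * z - z ^ 2 + 8 * g) ^ 3 -
      ((-2 * z ^ 3 + 9 * s * z ^ 2 + 24 * g * z + 144 * d) + 8 * s * (6 * s * z - z ^ 2 + 8 * g)) ^ 2 +
      6 * s * (6 * s * z - z ^ 2 + 8 * g) *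
        ((-2 * z ^ 3 + 9 * s * z ^ 2 + 24 * g * z + 144 * d) + 8 * s * (6 * s * z - z ^ 2 + 8 * g)) ≠ 0 := by
  decide

/-! ### §2. The discriminants of the two pairs -/

/-- **The Vélu pairs of a rational `3`-line on a tame pot.-good `III*` curve: `256·Δ = 3¹⁵·U` (`u = 1` pair) and
`256·Δ = 3³·U` (`u = 3` pair) with `3 ∤ U`.**  For `W/ℚ` globally minimal with `9 ∥ N`, `ord₃ Δ_min = 9`, `ord₃ j ≥ 0`
and `Ψ₃(q − b₂/12) = 0` there is an integer `U`, `3 ∤ U`, such that every `T/ℚ` with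
`(c₄, c₆)(T) = (1440q² − 9c₄(W), 60480q³ − 756c₄(W)q − 27c₆(W))` has `256·Δ(T) = 3¹⁵·U`, and every `T'/ℚ` with
`(3⁴c₄, 3⁶c₆)(T')` equal to that pair has `256·Δ(T') = 3³·U`. [cite: SilvermanATAEC1994, IV.9.4 Steps 6–9 and Table 4.1] -/
theorem exists_unit_velu_three_Δ_of_IIIstar (W : WeierstrassCurve ℚ) [W.IsElliptic] [W.IsGloballyMinimal]
    (h9 : 3 ^ 2 ∣ W.conductorNorm ℤ) (h27 : ¬ 3 ^ 3 ∣ W.conductorNorm ℤ)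
    (hΔ : padicValInt 3 W.minimalDiscriminantInt = 9) (hj : 0 ≤ padicValRat 3 W.j)
    (q : ℚ) (hq : W.Ψ₃.eval (q - W.b₂ / 12) = 0) :
    ∃ U : ℤ, ¬ (3 : ℤ) ∣ U ∧
      (∀ T : WeierstrassCurve ℚ, T.c₄ = 1440 * q ^ 2 - 9 * W.c₄ →
        T.c₆ = 60480 * q ^ 3 - 756 * W.c₄ * q - 27 * W.c₆ → 256 * T.Δ = 3 ^ 15 * (U : ℚ)) ∧
      (∀ T : WeierstrassCurve ℚ, (3 : ℚ) ^ 4 * T.c₄ = 1440 * q ^ 2 - 9 * W.c₄ →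
        (3 : ℚ) ^ 6 * T.c₆ = 60480 * q ^ 3 - 756 * W.c₄ * q - 27 * W.c₆ → 256 * T.Δ = 3 ^ 3 * (U : ℚ)) := by
  obtain ⟨r, β, γ, δ, ε, hγ, hε, hb₂, hb₄, hb₆, hb₈⟩ := exists_IIIstarShape_coeffs_three W h9 h27 hΔ hj
  have hc₄ : W.c₄ = 81 * ((β : ℚ) ^ 2 - 8 * γ) := by
    simp only [WeierstrassCurve.c₄]; rw [hb₂, hb₄]; ring
  have hc₆ : W.c₆ = -729 * ((β : ℚ) ^ 3 - 12 * β * γ + 72 * δ) := by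
    simp only [WeierstrassCurve.c₆]; rw [hb₂, hb₄, hb₆]; ring
  have hy : (4 * q - 3 * β) ^ 4 + 12 * β * (4 * q - 3 * β) ^ 3 + 432 * γ * (4 * q - 3 * β) ^ 2 +
      15552 * δ * (4 * q - 3 * β) + 62208 * ε = 0 := by
    simp only [WeierstrassCurve.Ψ₃, eval_add, eval_mul, eval_pow, eval_C, eval_X, eval_ofNat] at hq
    rw [hb₂, hb₄, hb₆, hb₈] at hq
    have hε' : (4 * ε : ℚ) = 3 * β * δ - γ ^ 2 := by exact_mod_cast hε
    linear_combination (256 / 3 : ℚ) * hq + 5184 * hε' - 5184 * hε'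
  obtain ⟨z, σ, hyz, hσ, hz3, hzeq⟩ := exists_int_of_psi3IIIstar_root hγ hε hy
  have hq' : q = 9 * (σ : ℚ) / 4 := by
    have hσ' : ((z + β : ℤ) : ℚ) = 3 * σ := by exact_mod_cast hσ
    push_cast at hσ'
    linear_combination hyz / 4 + 3 * hσ' / 4
  have hβ : (β : ℚ) = 3 * σ - z := by
    have hσ' : ((z + β : ℤ) : ℚ) = 3 * σ := by exact_mod_cast hσ
    push_cast at hσ'
    linear_combination hσ'
  -- (★): `576σδ = (z² − 8γ)² − 4σz³`
  have hstar : (z ^ 2 - 8 * γ) ^ 2 - 4 * σ * z ^ 3 - 576 * σ * δ = 0 := by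
    have h3 : (3 : ℤ) * ((z ^ 2 - 8 * γ) ^ 2 - 4 * σ * z ^ 3 - 576 * σ * δ) = 0 := by
      linear_combination (-1 : ℤ) * hzeq + 192 * hε + (4 * z ^ 3 + 576 * δ) * hσ
    exact (mul_eq_zero.mp h3).resolve_left (by norm_num)
  set A : ℤ := 6 * σ * z - z ^ 2 + 8 * γ with hA
  set B : ℤ := -2 * z ^ 3 + 9 * σ * z ^ 2 + 24 * γ * z + 144 * δ with hB
  refine ⟨4 * σ ^ 3 * (B + 8 * σ * A) + 3 * σ ^ 2 * A ^ 2 + 4 * A ^ 3 - (B + 8 * σ * A) ^ 2 +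
    6 * σ * A * (B + 8 * σ * A), ?_, ?_, ?_⟩
  · -- the unit
    intro h3U
    refine unit_IIIstar_decide (σ : ZMod 3) z γ δ
      (by rwa [Ne, ZMod.intCast_zmod_eq_zero_iff_dvd]) (by rwa [Ne, ZMod.intCast_zmod_eq_zero_iff_dvd]) ?_ ?_
    · have h := congrArg (Int.cast : ℤ → ZMod 3) hstar; push_cast at h ⊢; exact h
    · have h := (ZMod.intCast_zmod_eq_zero_iff_dvd _ 3).mpr h3U
      rw [hA, hB] at h; push_cast at h; exact h
  · intro T h4 h6
    have h := T.c_relation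
    rw [h4, h6, hc₄, hc₆, hq', hβ] at h
    rw [hA, hB]; push_cast
    linear_combination (4 / 27 : ℚ) * h
  · intro T h4 h6
    have h := T.c_relation
    have h4' : T.c₄ = (1440 * q ^ 2 - 9 * W.c₄) / 3 ^ 4 := by rw [← h4]; ring
    have h6' : T.c₆ = (60480 * q ^ 3 - 756 * W.c₄ * q - 27 * W.c₆) / 3 ^ 6 := by rw [← h6]; ring
    rw [h4', h6', hc₄, hc₆, hq', hβ] at h
    rw [hA, hB]; push_cast
    linear_combination (4 / 27 : ℚ) * h

/-- `ord₃ 256 = 0`. [elementary] -/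
private theorem padicValRat_three_twofiftysix : padicValRat 3 (256 : ℚ) = 0 := by
  rw [show (256 : ℚ) = ((256 : ℕ) : ℚ) by norm_num, padicValRat.of_nat]
  norm_cast
  exact padicValNat.eq_zero_of_not_dvd (by norm_num)

/-! ### §3. The law on the `III*` stratum, valuations -/

/-- **E-an-108 `TameThreeNeronScalarLawIIIstar`, conjunct 3 (cell bsd-f2-manin, MEMO-an §66; census 8 650 / 8 650 `III* → III`
rational `3`-isogenies, `u = 3`): on a globally minimal `W/ℚ`, TAME at `3` (`9 ∥ N`) with `ord₃ Δ_min = 9`, `ord₃ j ≥ 0`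
(pot.-good `III*`), for every rational `3`-line (`Ψ₃(q − b₂/12) = 0`) every globally minimal `W'` with
`3⁴c₄(W') = 1440q² − 9c₄(W)`, `3⁶c₆(W') = 60480q³ − 756c₄(W)q − 27c₆(W)` has `ord₃ Δ_min(W') = 3`** (type `III`).
[cite: SilvermanATAEC1994, IV.9.4 Steps 6–9 and Table 4.1] [cite: SilvermanAEC2009, III.1 Table 3.1] -/
theorem padicValInt_minimalDiscriminantInt_eq_three_of_three_velu_three_of_IIIstar (W : WeierstrassCurve ℚ)
    [W.IsElliptic] [W.IsGloballyMinimal] (h9 : 3 ^ 2 ∣ W.conductorNorm ℤ) (h27 : ¬ 3 ^ 3 ∣ W.conductorNorm ℤ)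
    (hΔ : padicValInt 3 W.minimalDiscriminantInt = 9) (hj : 0 ≤ padicValRat 3 W.j)
    (q : ℚ) (hq : W.Ψ₃.eval (q - W.b₂ / 12) = 0)
    (W' : WeierstrassCurve ℚ) [W'.IsElliptic] [W'.IsGloballyMinimal]
    (h4 : (3 : ℚ) ^ 4 * W'.c₄ = 1440 * q ^ 2 - 9 * W.c₄)
    (h6 : (3 : ℚ) ^ 6 * W'.c₆ = 60480 * q ^ 3 - 756 * W.c₄ * q - 27 * W.c₆) :
    padicValInt 3 W'.minimalDiscriminantInt = 3 := by
  obtain ⟨U, hU3, -, hT⟩ := exists_unit_velu_three_Δ_of_IIIstar W h9 h27 hΔ hj q hq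
  have hU0 : (U : ℚ) ≠ 0 := by
    have : U ≠ 0 := fun h ↦ hU3 (h ▸ dvd_zero 3)
    exact_mod_cast this
  have hΔ' : (W'.minimalDiscriminantInt : ℚ) = 3 ^ 3 * (U : ℚ) / 256 := by
    rw [cast_minimalDiscriminantInt]; linear_combination hT W' h4 h6 / 256
  have h3v : padicValRat 3 (3 : ℚ) = 1 := by exact_mod_cast padicValRat.self (p := 3) (by norm_num)
  have hUv : padicValRat 3 (U : ℚ) = 0 := by rw [padicValRat.of_int, padicValInt.eq_zero_of_not_dvd hU3]; simp
  have hval : padicValRat 3 (W'.minimalDiscriminantInt : ℚ) = 3 := by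
    rw [hΔ', padicValRat.div (mul_ne_zero (pow_ne_zero _ three_ne_zero) hU0) (by norm_num),
      padicValRat.mul (pow_ne_zero _ three_ne_zero) hU0, padicValRat.pow (3 : ℚ), h3v, hUv,
      padicValRat_three_twofiftysix]
    simp
  rw [padicValRat.of_int] at hval
  exact_mod_cast hval

/-- **The `u = 1` Vélu pair of a rational `3`-line on a tame pot.-good `III*` curve has `ord₃ Δ = 15`** — for any model
`T/ℚ` carrying it (e.g. Vélu's curve, or the globally minimal `W₁` of a TRIPLED optimal pair at `9p`, p3-g6
`velu_three_of_tripled_nine_mul_prime`); in particular it is not a minimal pair (p642603, again).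
[cite: SilvermanATAEC1994, IV.9.4 Table 4.1] -/
theorem padicValRat_Δ_eq_fifteen_of_velu_three_of_IIIstar (W : WeierstrassCurve ℚ) [W.IsElliptic]
    [W.IsGloballyMinimal] (h9 : 3 ^ 2 ∣ W.conductorNorm ℤ) (h27 : ¬ 3 ^ 3 ∣ W.conductorNorm ℤ)
    (hΔ : padicValInt 3 W.minimalDiscriminantInt = 9) (hj : 0 ≤ padicValRat 3 W.j)
    (q : ℚ) (hq : W.Ψ₃.eval (q - W.b₂ / 12) = 0) (T : WeierstrassCurve ℚ)
    (h4 : T.c₄ = 1440 * q ^ 2 - 9 * W.c₄) (h6 : T.c₆ = 60480 * q ^ 3 - 756 * W.c₄ * q - 27 * W.c₆) :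
    padicValRat 3 T.Δ = 15 := by
  obtain ⟨U, hU3, hT, -⟩ := exists_unit_velu_three_Δ_of_IIIstar W h9 h27 hΔ hj q hq
  have hU0 : (U : ℚ) ≠ 0 := by
    have : U ≠ 0 := fun h ↦ hU3 (h ▸ dvd_zero 3)
    exact_mod_cast this
  have hΔ' : T.Δ = 3 ^ 15 * (U : ℚ) / 256 := by linear_combination hT T h4 h6 / 256
  have h3v : padicValRat 3 (3 : ℚ) = 1 := by exact_mod_cast padicValRat.self (p := 3) (by norm_num)
  have hUv : padicValRat 3 (U : ℚ) = 0 := by rw [padicValRat.of_int, padicValInt.eq_zero_of_not_dvd hU3]; simp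
  rw [hΔ', padicValRat.div (mul_ne_zero (pow_ne_zero _ three_ne_zero) hU0) (by norm_num),
    padicValRat.mul (pow_ne_zero _ three_ne_zero) hU0, padicValRat.pow (3 : ℚ), h3v, hUv,
    padicValRat_three_twofiftysix]
  simp

end Summit.BirchSwinnertonDyer.BirchSwinnertonDyer.Theorems.ManinLocalTwoThree

end
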